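import Summits.HodgeConjecture.HodgeCM.PerL34.Doubling_1

/-! PORT of `HodgeCM/PerL34/Doubling.lean` (HodgeCMPerL run 81) — part 2: continuation of `Summits.HodgeConjecture.HodgeCM.PerL34.Doubling_1` (split at a top-level declaration boundary by port_pkg.py; scope re-opened below; declarations unchanged). -/

-- port_pkg: scope re-opened for this part (file-level context, then the namespace/section stack open at the cut)
set_option autoImplicit false
namespace HodgeCM.PerL34.Doubling
noncomputable section Datum
open scoped ComplexConjugate InnerProductSpace
/-- PerL v5 tex ll. 552–562, the adelic doubling data for ONE line `W_i`, POSITED.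
Parameters: `A = U(W_i)(𝔸) = 𝔸¹_L` (abelian), `H = U(W^□)(𝔸)`, `S = 𝒮((V₃ ⊗ W_i)(𝔸))` with its
`L²` inner product (a pre-Hilbert space), `Sbox = 𝒮((V₃ ⊗ W^∇)(𝔸))` (Schrödinger model of the
polarisation `W^□ = W^Δ ⊕ W^∇`). -/
structure DoublingDatum (A H S Sbox : Type*) [CommGroup A] [Group H]
    [NormedAddCommGroup S] [InnerProductSpace ℂ S] [AddCommGroup Sbox] [Module ℂ Sbox] where
  /-- tex l. 552: `ι : U(W_i) × U(−W_i) = U(W_i) × U(W_i) ↪ H` (on adelic points; the algebraic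
  map is `iota` of Part A). -/
  ι : A × A →* H
  ι_injective : Function.Injective ι
  /-- tex l. 259–262 / 553: `ω = ω_{W_i, μ_i}`, the Weil representation of `U(W_i)(𝔸)` on
  `𝒮((V₃ ⊗ W_i)(𝔸))`, by unitary operators for the `L²` product. -/
  ω : A →* (S ≃ₗᵢ[ℂ] S)
  /-- tex l. 552–555: `ω^□`, "the Weil representation of `H(𝔸) × G_U(𝔸)` on
  `𝒮((V₃ ⊗ W^∇)(𝔸))` (Schrödinger model of the polarisation, same `ψ, χ_V`, and `G_U`-side
  character `μ_i μ_i⁻¹ = 1`; this is `ω_{ψ,χ_V,W_n,V_r}` of [GQT, §11.3] with `n = 1` and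
  `V_r = V_3`, `m = 3`, Witt index `r = 0`, on which `G_U` acts linearly)"; only its restriction
  to `H(𝔸)` is posited here. -/
  ωbox : H →* (Sbox ≃ₗ[ℂ] Sbox)
  /-- evaluation of a Schwartz function at `0 ∈ (V₃ ⊗ W^∇)(𝔸)` (tex l. 562–563). -/
  ev0 : Sbox →ₗ[ℂ] ℂ
  /-- tex l. 558–559: "`χ_V ∘ det` … for the line `W_i`, `det` is the identity of
  `U(W_i)(𝔸) = 𝔸¹_L ⊂ 𝔸_L^×`, on which the Hecke character `χ_V` of `L` is evaluated; we write
  `χ_V(h)` for `h ∈ U(W_i)(𝔸)`" — a unitary character. -/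
  χV : A →* ℂ
  norm_χV : ∀ a : A, ‖χV a‖ = 1
  /-- tex l. 560–561: `(φ₁, φ₂) ↦ δ(φ₁ ⊗ φ̄₂)`, "realising `ω^∨` on complex conjugates `φ̄₂` of
  `φ₂ ∈ 𝒮((V₃ ⊗ W_i)(𝔸))`": complex-linear in `φ₁`, conjugate-linear in `φ₂`. -/
  δ : S →ₗ[ℂ] S →ₗ⋆[ℂ] Sbox
  /-- LABEL (referee 2, G-R2-14): **PRINT-DERIVED (class U-derived)** — NOT a verbatim published
  statement but the UNWINDING, on pure tensors, of the two published displays quoted next; the hand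
  derivation is recorded at the end of this docstring.
  PRINT SOURCE [GQT] §11.3 (arXiv:1207.4709 = Invent. Math. 198 (2014)), the two closing displays,
  verbatim: "By [K2] and [HKS], one knows that
  `ω_{ψ,χ_V,W_n,V_r}|_{G(U_n) × G(U_n)} = ω_{ψ,χ_V,U_n,V_r} ⊗ (ω_{ψ,χ_V,U_n,V_r}^∨ · (χ_V ∘ det))|_{G(U_n) × G(U_n)}`.
  Indeed, there is an isomorphism [Li]
  `δ : ω_{ψ,χ_V,U_n,V_r} ⊗ (ω_{ψ,χ_V,U_n,V_r}^∨ · (χ_V ∘ det)) ⟶ ω_{ψ,χ_V,W_n,V_r}`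
  such that `δ(φ₁ ⊗ φ̄₂)(0) = ⟨φ₁, φ₂⟩` for `φ_i ∈ 𝒮(𝕏)(𝔸)`."  Here `U_n = W_i` (`n = 1`),
  `U_n^- = −W_i`, `W_n = U_n ⊕ U_n^- = W^□` with `Y_n = U_n^Δ`, `Y_n^* = U_n^∇`, `V_r = V₃`.
  As used by PerL tex l. 557–561 and l. 568: `δ` intertwines, the twist `χ_V ∘ det` sitting on
  the SECOND factor and `ω^∨` realised on complex conjugates, i.e.
  `ω^□(ι(h₁,h₂)) δ(φ₁ ⊗ φ̄₂) = δ(ω(h₁)φ₁ ⊗ χ_V(h₂) \overline{ω(h₂)φ₂})`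
  (the locus of the R4 first error of the 2026-08-09 reviews: twist omitted in v4).
  DERIVATION (recorded for the U-derived label): display 1 says that, transported through the
  isomorphism `δ`, the restriction of `ω^□ := ω_{ψ,χ_V,W_n,V_r}` to `ι(G(U_n) × G(U_n))` is the
  (completed) tensor product representation `ω ⊗ (ω^∨ · (χ_V ∘ det))`, i.e. for all `h₁, h₂` and all
  pure tensors `φ₁ ⊗ λ`, `ω^□(ι(h₁,h₂)) δ(φ₁ ⊗ λ) = δ(ω(h₁)φ₁ ⊗ χ_V(det h₂) ω^∨(h₂)λ)`; realise the
  contragredient `ω^∨` of the unitary representation `ω` on complex conjugates, `λ = φ̄₂`,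
  `ω^∨(h₂)φ̄₂ = \overline{ω(h₂)φ₂}` (PerL l. 560–561), and use `det = id` on `G(U_1) = U(W_i) = 𝔸¹_L`
  (PerL l. 558); conjugate-linearity of `φ₂ ↦ δ(φ₁ ⊗ φ̄₂)` moves the scalar `χ_V(h₂)` out as written
  (`δ φ₁ (c̄ • φ₂) = c • δ φ₁ φ₂` would put `\overline{χ_V(h₂)}` inside the second slot equivalently). -/
  equivariant : ∀ (h₁ h₂ : A) (φ₁ φ₂ : S),
    ωbox (ι (h₁, h₂)) (δ φ₁ φ₂) = χV h₂ • δ (ω h₁ φ₁) (ω h₂ φ₂)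
  /-- LABEL (referee 2, G-R2-14): **PRINT (class P)**, verbatim with locator: [GQT] §11.3, last
  display (arXiv:1207.4709 p. 33 of the arXiv text, ll. 150–170 of the held chunk
  `paper:arxiv-1207.4709/p0033`; Invent. Math. 198 (2014) 739–831, §11.3): "such that
  `δ(φ₁ ⊗ φ̄₂)(0) = ⟨φ₁, φ₂⟩` for `φ_i ∈ 𝒮(𝕏)(𝔸)`" — there attributed to [Li92] = J.-S. Li, J. reine
  angew. Math. 428 (1992) 177–217 (PerL cites "p. 182, (12)": `δ` is a partial Fourier transform;
  Crelle 428 is NOT HELD — acquisition request acq-07570 — so the Li92 locator is UNVERIFIED and the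
  citable published statement is GQT's display). PerL tex l. 561–562. With PerL's bracket
  `⟨φ₁, φ₂⟩ = ∫ φ₁ φ̄₂ = pair φ₁ φ₂ = ⟪φ₂, φ₁⟫_ℂ`. -/
  ev0_δ : ∀ φ₁ φ₂ : S, ev0 (δ φ₁ φ₂) = pair φ₁ φ₂

namespace DoublingDatum

variable {A H S Sbox : Type*} [CommGroup A] [Group H]
  [NormedAddCommGroup S] [InnerProductSpace ℂ S] [AddCommGroup Sbox] [Module ℂ Sbox]
  (D : DoublingDatum A H S Sbox)

/-- (Ported verbatim from the HodgeCMPerL package; no docstring in the source.) -/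
@[simp] theorem δ_smul_right (c : ℂ) (φ₁ φ₂ : S) :
    D.δ φ₁ (c • φ₂) = conj c • D.δ φ₁ φ₂ :=
  LinearMap.map_smulₛₗ (D.δ φ₁) c φ₂

/-- (Ported verbatim from the HodgeCMPerL package; no docstring in the source.) -/
@[simp] theorem δ_smul_left (c : ℂ) (φ₁ φ₂ : S) :
    D.δ (c • φ₁) φ₂ = c • D.δ φ₁ φ₂ := by
  rw [LinearMap.map_smul, LinearMap.smul_apply]

attribute [simp] DoublingDatum.ev0_δ

/-- (Ported verbatim from the HodgeCMPerL package; no docstring in the source.) -/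
theorem χV_ne_zero (a : A) : D.χV a ≠ 0 := by
  intro h0; have := D.norm_χV a; rw [h0, norm_zero] at this; exact zero_ne_one this

/-- (Ported verbatim from the HodgeCMPerL package; no docstring in the source.) -/
theorem χV_mul_conj (a : A) : D.χV a * conj (D.χV a) = 1 := by
  rw [Complex.mul_conj, Complex.normSq_eq_norm_sq, D.norm_χV]; simp

/-- (Ported verbatim from the HodgeCMPerL package; no docstring in the source.) -/
theorem χV_inv (a : A) : D.χV a⁻¹ = conj (D.χV a) := by
  have h1 : D.χV a⁻¹ * D.χV a = 1 := by rw [← map_mul, inv_mul_cancel, map_one]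
  have h2 := D.χV_mul_conj a
  calc D.χV a⁻¹ = D.χV a⁻¹ * (D.χV a * conj (D.χV a)) := by rw [h2, mul_one]
    _ = (D.χV a⁻¹ * D.χV a) * conj (D.χV a) := by ring
    _ = conj (D.χV a) := by rw [h1, one_mul]

/-- tex l. 563: `Φ := δ(φ ⊗ φ̄)`. -/
def Φ (φ : S) : Sbox := D.δ φ φ

/-- (Ported verbatim from the HodgeCMPerL package; no docstring in the source.) -/
theorem Φ_def (φ : S) : D.Φ φ = D.δ φ φ := rfl

/-- tex l. 563: the Siegel–Weil section at `s₀`, as a function on `H(𝔸)`: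
`f_Φ(h, s₀) := (ω^□(h)Φ)(0)`. (Its extension to a standard section in `s` and the induced
space it lies in are tex ll. 569–572 = node N31d.) -/
def fSW (Ψ : Sbox) (x : H) : ℂ := D.ev0 (D.ωbox x Ψ)

/-- (Ported verbatim from the HodgeCMPerL package; no docstring in the source.) -/
theorem fSW_def (Ψ : Sbox) (x : H) : D.fSW Ψ x = D.ev0 (D.ωbox x Ψ) := rfl

/-- (Ported verbatim from the HodgeCMPerL package; no docstring in the source.) -/
theorem fSW_one (φ₁ φ₂ : S) : D.fSW (D.δ φ₁ φ₂) 1 = pair φ₁ φ₂ := by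
  simp [fSW_def]

/-- The equivariance of `δ` transported to `f`: `f_{δ(φ₁⊗φ̄₂)}(ι(h₁,h₂)·x)`
`= χ_V(h₂) · f_{δ(ω(h₁)φ₁ ⊗ \overline{ω(h₂)φ₂})}(x)` — the general form of the computation at
tex l. 568–569 (the special case `x = 1`, `φ₁ = φ₂ = φ` is (eq:basic), node N31c). -/
theorem fSW_ι_mul (h₁ h₂ : A) (φ₁ φ₂ : S) (x : H) :
    D.fSW (D.δ φ₁ φ₂) (x * D.ι (h₁, h₂))
      = D.χV h₂ * D.fSW (D.δ (D.ω h₁ φ₁) (D.ω h₂ φ₂)) x := by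
  simp only [fSW_def, map_mul, LinearEquiv.mul_apply, D.equivariant, map_smul, smul_eq_mul]

end DoublingDatum

end Datum

/-! ## The node statement (N31b) as an honest split

`N31b_statement` records, for a hermitian line `(W, h)` over `L` and a posited adelic doubling
datum, the content of tex ll. 549–562: (i) the polarisation facts (PROVED, Part A) and (ii) the
two print identities (HYPOTHESIS FIELDS of the datum, Part B). It is stated over the posited
DATA structure `DoublingDatum` (LEMMAS.md §3 D4: "typed … as a placeholder Prop over a posited
DATA structure until the def exists"). -/

noncomputable section Statement

open scoped InnerProductSpace

variable {L : Type*} [CommRing L] [StarRing L] {W : Type*} [AddCommGroup W] [Module L W]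
variable {A H S Sbox : Type*} [CommGroup A] [Group H]
  [NormedAddCommGroup S] [InnerProductSpace ℂ S] [AddCommGroup Sbox] [Module ℂ Sbox]

/-- N31b (tex ll. 549–562) over the data `(h, D)`. -/
def N31b_statement (h : Sesq L W) (D : DoublingDatum A H S Sbox) : Prop :=
  -- (i) l. 549–551: W^Δ, W^∇ totally isotropic for h ⊕ (−h), complementary when 2 ∈ Lˣ
  (∀ x ∈ Delta L W, ∀ y ∈ Delta L W, hbox h x y = 0) ∧
  (∀ x ∈ Nabla L W, ∀ y ∈ Nabla L W, hbox h x y = 0) ∧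
  (Invertible (2 : L) → IsCompl (Delta L W) (Nabla L W)) ∧
  -- l. 551–552: ι is an embedding and ι(g₁,g₂) stabilises the line W^Δ iff g₁ = g₂
  Function.Injective (iota h) ∧
  (∀ g : isom h × isom h, (∀ x ∈ Delta L W, iotaEquiv h g x ∈ Delta L W) ↔ g.1 = g.2) ∧
  -- (ii) l. 555–562: twisted restriction realised by δ, and δ(φ₁⊗φ̄₂)(0) = ⟨φ₁,φ₂⟩
  (∀ (h₁ h₂ : A) (φ₁ φ₂ : S),
    D.ωbox (D.ι (h₁, h₂)) (D.δ φ₁ φ₂) = D.χV h₂ • D.δ (D.ω h₁ φ₁) (D.ω h₂ φ₂)) ∧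
  (∀ φ₁ φ₂ : S, D.ev0 (D.δ φ₁ φ₂) = pair φ₁ φ₂)

/-- N31b holds for every hermitian line and every posited doubling datum: part (i) is proved in
Part A, part (ii) is the two PRINT hypothesis fields ([GQT] §11.3) of the datum. -/
theorem N31b_holds (h : Sesq L W) (D : DoublingDatum A H S Sbox) : N31b_statement h D :=
  ⟨fun _ hx _ hy => hbox_Delta h hx hy,
   fun _ hx _ hy => hbox_Nabla h hx hy,
   fun _ => isCompl_Delta_Nabla,
   iota_injective h,
   iota_mapsTo_Delta_iff h,
   D.equivariant,
   D.ev0_δ⟩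

end Statement

end HodgeCM.PerL34.Doubling
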